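import Summits.ValiantsHypothesis.ValiantsHypothesis.Theorems.ImmanantSliceTwoClassRigiditySplit

/-!
# `TwoClassRigidityOfDcSplit` (stmt-ValiantsHypothesis-21292) — route ImmanantSlice, A4 split glue

The glue decl `TwoClassRigidityOfDcSplit : SliceVBP → DcTwoClassRigidity → TwoClassRigidity` (tenure sweep g1,
route ImmanantSlice rev 4) has, verbatim, the two hypotheses and the conclusion of the landed theorem
`Summit.ValiantsHypothesis.Theorems.TwoClassRigiditySplit.twoClassRigidity_of_sliceVPInVBP_of_dcTwoClassRigidity`
(`Theorems/ImmanantSliceTwoClassRigiditySplit.lean`, p552055).  This file only records the closing link under the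
route decl's name.  Pure bookkeeping; VP ≠ VNP is not moved by this file.
-/

set_option linter.dupNamespace false

namespace Summit.ValiantsHypothesis.Theorems.TwoClassRigiditySplit

/-- stmt-ValiantsHypothesis-21292 `TwoClassRigidityOfDcSplit`: `SliceVBP → DcTwoClassRigidity → TwoClassRigidity`,
by the landed `twoClassRigidity_of_sliceVPInVBP_of_dcTwoClassRigidity`. -/
theorem twoClassRigidityOfDcSplit_proof :
    Summit.ValiantsHypothesis.ValiantsHypothesis.Theses.ImmanantSlice.TwoClassRigidityOfDcSplit := by
  unfold Summit.ValiantsHypothesis.ValiantsHypothesis.Theses.ImmanantSlice.TwoClassRigidityOfDcSplit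
  exact Summit.ValiantsHypothesis.Theorems.TwoClassRigiditySplit.twoClassRigidity_of_sliceVPInVBP_of_dcTwoClassRigidity

end Summit.ValiantsHypothesis.Theorems.TwoClassRigiditySplit
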